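import Mathlib.Analysis.Normed.Operator.BanachSteinhaus
import Literature.Analysis.UnboundedOperators.StrongContRepresentation
import HarnessLib

/-!
# Differentiability of orbits of a C₀-semigroup (discharge of `hasDerivWithinAt_app_of_mem`)

Sibling proof file of `Literature/Analysis/UnboundedOperators/StrongContRepresentation.lean`
(item C3, `C0Semigroup`), which records the named fact

* `Literature.Analysis.UnboundedOperators.C0Semigroup.hasDerivWithinAt_app_of_mem`:
  for a C₀-semigroup `(T(t))_{t ≥ 0}` on a Banach space and `x ∈ D(A)`, the orbit `s ↦ T(s) x` is
  differentiable on `[0, ∞)` (two-sided at `t > 0`, from the right at `t = 0`) with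
  `d/dt T(t) x = T(t) A x` (Engel–Nagel (2000), Ch. II Lemma 1.3 (ii)).

This file proves it (`C0Semigroup.hasDerivWithinAt_app_of_mem_holds`) along the printed proof
(Engel–Nagel (2000), Ch. II Lemma 1.1, (b) ⇒ (a), and Lemma 1.3 (ii)), in "real time"
`s ↦ T(s⁺) x` (`s⁺ = Real.toNNReal s`, the parametrisation used by `C0Semigroup.generatorGraph`):

* `C0Semigroup.exists_norm_app_le`: every C₀-semigroup on a Banach space is uniformly bounded on
  compact time intervals, `‖T(s)‖ ≤ M` for `0 ≤ s ≤ t` (the finite orbits `{T(s) x : s ∈ [0, t]}`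
  are continuous images of a compact interval, hence bounded, and the uniform boundedness principle
  applies; Engel–Nagel (2000), Ch. I Prop. 5.5 and the paragraph preceding it; Mathlib:
  `banach_steinhaus`);
* `C0Semigroup.hasDerivWithinAt_Icc_app_of_mem`: the *left* derivative at `t` within `[0, t]` is
  `T(t) A x`: for `0 ≤ s < t` and `h := t - s > 0`,
  `h⁻¹ (T(t) x - T(s) x) - T(t) A x = T(s) (h⁻¹ (T(h) x - x) - A x) + (T(s) A x - T(t) A x)`,
  where the first term tends to `0` as `s ↑ t` because `‖T(s)‖ ≤ M` on `[0, t]` and the second by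
  strong continuity (the display in the proof of Engel–Nagel Lemma II.1.1);
* `C0Semigroup.hasDerivWithinAt_app_of_mem_holds`: glue with the right derivative within `[t, ∞)`
  (tree lemma `C0Semigroup.hasDerivWithinAt_Ici_app_of_mem`, which needs no completeness) via
  `[0, t] ∪ [t, ∞) = [0, ∞)`; and the two-sided corollary `C0Semigroup.hasDerivAt_app_of_mem` at
  `t > 0`.

The group analogue of the local bound (`OneParameterGroup.exists_norm_app_le`) is in
`Literature/Analysis/UnboundedOperators/UnitaryGroupGenerator.lean`.

## References

* K.-J. Engel, R. Nagel, *One-Parameter Semigroups for Linear Evolution Equations* (Springer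
  GTM 194, 2000), Ch. I Prop. 5.5, Ch. II Lemma 1.1, Def. 1.2, Lemma 1.3 (ii) (same text and
  numbering of Ch. II §1 in K.-J. Engel, R. Nagel, *A Short Course on Operator Semigroups*,
  Universitext, Springer 2006, Ch. II §1, pp. 31–33; local boundedness ibid. Ch. I Prop. 1.4,
  p. 7). [EngelNagel2000]

## Design notes

* As in the statement of the fact, `E` carries a real normed-space structure compatible with the
  `𝕜`-structure (`[NormedSpace ℝ E] [IsScalarTower ℝ 𝕜 E]`): slopes of the real-time orbit are real
  scalar multiples, the difference quotient of `generatorGraph` is a `𝕜`-scalar multiple, and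
  `RCLike.real_smul_eq_coe_smul` converts between them.
* No definitions; theorems only.
-/

noncomputable section

open Filter Topology
open scoped NNReal

namespace Literature.Analysis.UnboundedOperators

namespace C0Semigroup

variable {𝕜 E : Type*} [RCLike 𝕜] [NormedAddCommGroup E] [NormedSpace 𝕜 E]

/-- Every C₀-semigroup on a Banach space is uniformly bounded on compact time intervals: for each
`t ≥ 0` there is `M` with `‖T(s)‖ ≤ M` for all `0 ≤ s ≤ t`. Proof as printed: each finite orbit
`{T(s) x : s ∈ [0, t]}` is the continuous image of a compact interval, hence bounded, and the uniform
boundedness principle (Mathlib: `banach_steinhaus`) applies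
(Engel–Nagel (2000), Ch. I Prop. 5.5 and the paragraph preceding it).
[cite: EngelNagel2000, Ch. I Prop. 5.5] -/
theorem exists_norm_app_le [CompleteSpace E] (T : C0Semigroup 𝕜 E) (t : ℝ≥0) :
    ∃ M : ℝ, ∀ s ≤ t, ‖T.app s‖ ≤ M := by
  obtain ⟨M, hM⟩ := banach_steinhaus (g := fun s : Set.Icc (0 : ℝ≥0) t => T.app (s : ℝ≥0))
    fun x => by
      obtain ⟨C, hC⟩ := (isCompact_Icc (a := (0 : ℝ≥0)) (b := t)).exists_bound_of_continuousOn
        (T.continuous_app x).continuousOn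
      exact ⟨C, fun s => hC s s.2⟩
  exact ⟨M, fun s hs => hM ⟨s, zero_le, hs⟩⟩

section Deriv

variable [NormedSpace ℝ E] [IsScalarTower ℝ 𝕜 E] [CompleteSpace E]

/-- Left differentiability of orbits: for a C₀-semigroup on a Banach space, `x ∈ D(A)` and
`t ≥ 0`, the real-time orbit `s ↦ T(s⁺) x` has derivative `T(t) A x` at `t` within `[0, t]`
(the left-derivative half of Engel–Nagel (2000), Ch. II Lemma 1.1 / Lemma 1.3 (ii): for
`0 ≤ s < t`, `h = t - s`, `h⁻¹ (T(t) x - T(s) x) - T(t) A x = T(s) (h⁻¹ (T(h) x - x) - A x)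
+ (T(s) A x - T(t) A x)`, the first term `→ 0` by the local bound `exists_norm_app_le`, the second
by strong continuity). [cite: EngelNagel2000, Ch. II Lemma 1.3] -/
theorem hasDerivWithinAt_Icc_app_of_mem (T : C0Semigroup 𝕜 E) (x : T.generator.domain) (t : ℝ≥0) :
    HasDerivWithinAt (fun s : ℝ => T.app s.toNNReal (x : E)) (T.app t (T.generator x))
      (Set.Icc 0 (t : ℝ)) t := by
  obtain ⟨M, hM⟩ := T.exists_norm_app_le t
  rw [hasDerivWithinAt_iff_tendsto_slope, Set.Icc_sdiff_right]
  -- `s ↦ t - s` maps `𝓝[Ico 0 t] t` into `𝓝[>] 0`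
  have hshift : Tendsto (fun s : ℝ => (t : ℝ) - s) (𝓝[Set.Ico 0 (t : ℝ)] t) (𝓝[>] 0) := by
    refine tendsto_nhdsWithin_of_tendsto_nhds_of_eventually_within _ ?_ ?_
    · exact ((continuous_sub_left (t : ℝ)).tendsto' _ _ (sub_self _)).mono_left
        nhdsWithin_le_nhds
    · filter_upwards [self_mem_nhdsWithin] with s hs
      exact Set.mem_Ioi.mpr (sub_pos.mpr hs.2)
  -- the difference quotient at `h = t - s`, minus `A x`, tends to `0` as `s ↑ t`
  have h1 : Tendsto (fun s : ℝ => ((((t : ℝ) - s)⁻¹ : ℝ) : 𝕜) •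
      (T.app ((t : ℝ) - s).toNNReal (x : E) - x) - T.generator x)
      (𝓝[Set.Ico 0 (t : ℝ)] t) (𝓝 0) := by
    have := ((T.tendsto_generator x).comp hshift).sub_const (T.generator x)
    rw [sub_self] at this
    exact this
  -- first term: `T(s) (h⁻¹ (T(h) x - x) - A x) → 0`, since `‖T(s)‖ ≤ M` for `s ∈ [0, t]`
  have h2 : Tendsto (fun s : ℝ => T.app s.toNNReal (((((t : ℝ) - s)⁻¹ : ℝ) : 𝕜) •
      (T.app ((t : ℝ) - s).toNNReal (x : E) - x) - T.generator x))
      (𝓝[Set.Ico 0 (t : ℝ)] t) (𝓝 0) := by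
    have hg : Tendsto (fun s : ℝ => M * ‖((((t : ℝ) - s)⁻¹ : ℝ) : 𝕜) •
        (T.app ((t : ℝ) - s).toNNReal (x : E) - x) - T.generator x‖)
        (𝓝[Set.Ico 0 (t : ℝ)] t) (𝓝 0) := by
      have := h1.norm.const_mul M
      rw [norm_zero, mul_zero] at this
      exact this
    rw [tendsto_zero_iff_norm_tendsto_zero]
    refine squeeze_zero' (Eventually.of_forall fun s => norm_nonneg _) ?_ hg
    filter_upwards [self_mem_nhdsWithin] with s hs
    exact ((T.app s.toNNReal).le_opNorm _).trans (mul_le_mul_of_nonneg_right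
      (hM _ (Real.toNNReal_le_iff_le_coe.mpr hs.2.le)) (norm_nonneg _))
  -- second term: `T(s) A x → T(t) A x` by strong continuity
  have h3 : Tendsto (fun s : ℝ => T.app s.toNNReal (T.generator x)) (𝓝[Set.Ico 0 (t : ℝ)] t)
      (𝓝 (T.app t (T.generator x))) := by
    refine ((T.continuous_app (T.generator x)).tendsto' _ _ ?_).comp
      (continuous_real_toNNReal.continuousWithinAt (s := Set.Ico 0 (t : ℝ)) (x := (t : ℝ)))
    rw [Real.toNNReal_coe]
  have h4 := h2.add h3
  rw [zero_add] at h4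
  refine h4.congr' ?_
  filter_upwards [self_mem_nhdsWithin] with s hs
  obtain ⟨hs0, hst⟩ := hs
  -- `s⁺ + (t - s)⁺ = t`, so `T(t) x = T(s⁺) (T((t - s)⁺) x)`
  have hts : s.toNNReal + ((t : ℝ) - s).toNNReal = ((t : ℝ)).toNNReal := by
    apply NNReal.coe_injective
    rw [NNReal.coe_add, Real.coe_toNNReal _ hs0, Real.coe_toNNReal _ (sub_nonneg.mpr hst.le),
      Real.toNNReal_coe]
    ring
  rw [← map_add, sub_add_cancel]
  simp only [slope, vsub_eq_sub]
  rw [map_smul, map_sub, ← mul_apply_eq_comp, ← app_add, hts,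
    ← RCLike.real_smul_eq_coe_smul (K := 𝕜), ← neg_sub (t : ℝ) s, inv_neg, neg_smul, ← smul_neg,
    neg_sub]

/-- **Engel–Nagel (2000), Ch. II Lemma 1.3 (ii)** — discharge of the named fact
`hasDerivWithinAt_app_of_mem`: for a C₀-semigroup on a Banach space and `x ∈ D(A)`, the orbit
`s ↦ T(s) x` is differentiable on `[0, ∞)` (two-sided at `t > 0`, from the right at `t = 0`) with
`d/dt T(t) x = T(t) A x`. Obtained, exactly as in the printed proof of Lemma II.1.1, by gluing the
right derivative within `[t, ∞)` (`hasDerivWithinAt_Ici_app_of_mem`) and the left derivative within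
`[0, t]` (`hasDerivWithinAt_Icc_app_of_mem`) along `[0, t] ∪ [t, ∞) = [0, ∞)`.
[cite: EngelNagel2000, Ch. II Lemma 1.3] -/
theorem hasDerivWithinAt_Ici_zero_app_of_mem (T : C0Semigroup 𝕜 E) (x : T.generator.domain)
    (t : ℝ≥0) :
    HasDerivWithinAt (fun s : ℝ => T.app s.toNNReal (x : E)) (T.app t (T.generator x))
      (Set.Ici 0) t := by
  have h := (T.hasDerivWithinAt_Icc_app_of_mem x t).union (T.hasDerivWithinAt_Ici_app_of_mem x t)
  rwa [Set.Icc_union_Ici_eq_Ici t.coe_nonneg] at h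

/-- Two-sided differentiability at positive times: for a C₀-semigroup on a Banach space,
`x ∈ D(A)` and `t > 0`, the real-time orbit `s ↦ T(s⁺) x` has derivative `T(t) A x` at `t`
(Engel–Nagel (2000), Ch. II Lemma 1.3 (ii), formula (1.5) at `t > 0`).
[cite: EngelNagel2000, Ch. II Lemma 1.3] -/
theorem hasDerivAt_app_of_mem (T : C0Semigroup 𝕜 E) (x : T.generator.domain) {t : ℝ≥0}
    (ht : 0 < t) :
    HasDerivAt (fun s : ℝ => T.app s.toNNReal (x : E)) (T.app t (T.generator x)) t :=
  (T.hasDerivWithinAt_Ici_zero_app_of_mem x t).hasDerivAt (Ici_mem_nhds (NNReal.coe_pos.mpr ht))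

end Deriv

section Discharge

/-- **Discharge of `hasDerivWithinAt_app_of_mem`** (Engel–Nagel (2000), Ch. II Lemma 1.3 (ii)):
orbits of `x ∈ D(A)` under a C₀-semigroup on a Banach space are differentiable on `[0, ∞)` with
`d/dt T(t) x = T(t) A x`; this is `hasDerivWithinAt_Ici_zero_app_of_mem` with the instance
binders of the fact introduced. [cite: EngelNagel2000, Ch. II Lemma 1.3] -/
theorem hasDerivWithinAt_app_of_mem_holds : hasDerivWithinAt_app_of_mem (𝕜 := 𝕜) (E := E) := by
  intro _ _ _ T x t
  exact T.hasDerivWithinAt_Ici_zero_app_of_mem x t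

end Discharge

end C0Semigroup

end Literature.Analysis.UnboundedOperators
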